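import Literature.Analysis.FluidPDE.MillerMiddleEigenvalueTorus
import Literature.Analysis.FluidPDE.TorusClassicalHnBalance
import Literature.Analysis.FluidPDE.CheskidovAssemblyTools
import HarnessLib

/-!
# The dissipation lower bound `‖Δu‖₂² ≥ 2ℰ²/K` and `dℰ/dt ≤ -2νℰ²/K + (stretching bound)` on `T³` — PROVED

Analysis/FluidPDE proof file (theorems only: no definitions, no named facts).

The "well-known estimate in terms of `K` and `ℰ`" (Ayala–Protas 2017, eq. (2.6), after Doering 2009):
`dℰ/dt ≤ -ν ℰ²/K + (c/ν³) ℰ³`, `K = ½‖u‖₂²` (`Torus.kineticEnergy`), `ℰ = ½‖∇u‖₂²` (`torusEnstrophy`).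
Its first term comes from the interpolation `‖∇u‖₂⁴ = ⟨u, -Δu⟩² ≤ ‖u‖₂²‖Δu‖₂²` (integration by parts
and Cauchy–Schwarz), i.e. `ν‖Δu‖₂² ≥ 2νℰ²/K` — which is in fact TWICE the printed term (the printed
`-νℰ²/K` is the weaker consequence). This file proves, on `T^d` for smooth fields (any `d`):

* `two_mul_torusEnstrophy_sq_le` — `2 ℰ(w)² ≤ K(w) ‖Δw‖₂²` (i.e. `(‖∇w‖₂²)² ≤ ‖w‖₂² ‖Δw‖₂²`);
* `integral_inner_laplacian_convect_le_two_mul_vorticityBound_mul_torusEnstrophy` — the stretching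
  bound `∫⟪Δu,(u·∇)u⟫ ≤ 2Mℰ` under `|ω|² ≤ M²` (Doering–Gibbon (6.5.18), isolated);

and, along classical solutions of the unforced Navier–Stokes equations with `ν ≥ 0` on `T^d × [a, b]`,
`card d = 3`, `a < b`, with `K(u t) > 0`, for every one-sided derivative `R` of the enstrophy within
`[a, b]` at `t`, the three PROVED stretching bounds of the sibling files with the dissipation kept in
`K, ℰ` form:

* `enstrophyRate_le_dissipationKE_vorticitySup` — `R ≤ -2νℰ²/K + 2Mℰ` (`|ω|² ≤ M²`; Doering–Gibbon (6.5.18));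
* `enstrophyRate_le_dissipationKE_strain_cube` — `R ≤ -2νℰ²/K + (2√6/9)∫|S|³` (Miller Cor. 4.9);
* `enstrophyRate_le_dissipationKE_middleEigenvalue` — `R ≤ -2νℰ²/K + 2Λℰ` (`λ₂ ≤ Λ`; Miller Lemma 5.1).

These are the typed forms of the census control rows that carry the Rayleigh-quotient budget
`νZ/K` (pub-nsfunc DICTIONARY §6 G2, P0 rows) together with a stretching bound.

## Mathlib / tree search

Tree: `Torus.integral_inner_laplacian_self_eq_neg_gradNormSq` (`∫⟪Δw, w⟫ = -‖∇w‖₂²`,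
TorusClassicalHnBalance), `FluidPDE.abs_integral_inner_le_sqrt_mul_sqrt` (Cauchy–Schwarz,
CheskidovAssemblyTools), `DoeringGibbon1995_enstrophyRate_le_vorticitySup_holds`,
`Torus.IsClassicalNSSolutionOn.enstrophyRate_le_strain_cube`, `…enstrophyRate_le_middleEigenvalue_sup`,
`…hasDerivWithinAt_half_gradNormSq`. `lean search 'gradNormSq_sq_le|enstrophy_sq_le'`: only the
Summit-side `Summit.AnomalousDissipation.AnomalousDissipation.Theorems.gradNormSq_sq_le` (not importable
from Literature).

## References

* D. Ayala, B. Protas, J. Fluid Mech. 818 (2017) 772–806 = arXiv:1605.05742, eq. (2.6) (held text p. 5). [AyalaProtas2017]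
* C. R. Doering, J. D. Gibbon, *Applied Analysis of the Navier–Stokes Equations*, CUP 1995, §6.5 eq. (6.5.18). [DoeringGibbon1995]
* E. Miller, Arch. Ration. Mech. Anal. 235 (2020) 99–139, Cor. 4.9, Lemma 5.1. [Miller2019]
-/

noncomputable section

open Set MeasureTheory Finset Matrix
open scoped InnerProductSpace RealInnerProductSpace

namespace Literature.Analysis.FluidPDE

open Literature.Analysis.FunctionSpaces

variable {d : Type*} [Fintype d] [DecidableEq d]

/-- **`2ℰ² ≤ K ‖Δw‖₂²`** on `T^d` (`ℰ = ½‖∇w‖₂²`, `K = ½‖w‖₂²`), i.e. the interpolation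
`‖∇w‖₂⁴ = ⟨w, -Δw⟩² ≤ ‖w‖₂² ‖Δw‖₂²` for a smooth vector field (integration by parts and
Cauchy–Schwarz): the enstrophy–energy–palinstrophy inequality behind the `-νℰ²/K` term of
Ayala–Protas (2.6) (here with the sharp factor: `ν‖Δu‖₂² ≥ 2νℰ²/K`). (The bare `gradNormSq` form
is the Summit-side lemma `Summit.AnomalousDissipation.…gradNormSq_sq_le`; Literature cannot import
it, so the three-line argument is repeated inside this proof.) [cite: AyalaProtas2017, eq. (2.6)] -/
theorem two_mul_torusEnstrophy_sq_le {w : UnitAddTorus d → EuclideanSpace ℝ d}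
    (hw : Torus.IsSmooth w) :
    2 * torusEnstrophy w ^ 2 ≤ Torus.kineticEnergy w * ∫ x, ‖Torus.laplacian w x‖ ^ 2 := by
  have hid := Torus.integral_inner_laplacian_self_eq_neg_gradNormSq hw
  have hcs := abs_integral_inner_le_sqrt_mul_sqrt (μ := volume) (hw.laplacian.memLp 2) (hw.memLp 2)
  rw [hid, abs_neg] at hcs
  have hg0 : 0 ≤ Torus.gradNormSq w := Torus.gradNormSq_nonneg w
  rw [abs_of_nonneg hg0] at hcs
  have hA : 0 ≤ ∫ x, ‖Torus.laplacian w x‖ ^ 2 := integral_nonneg fun x => sq_nonneg _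
  have hB : 0 ≤ ∫ x, ‖w x‖ ^ 2 := integral_nonneg fun x => sq_nonneg _
  have h : Torus.gradNormSq w ^ 2 ≤ (∫ x, ‖w x‖ ^ 2) * ∫ x, ‖Torus.laplacian w x‖ ^ 2 :=
    calc Torus.gradNormSq w ^ 2
        ≤ (Real.sqrt (∫ x, ‖Torus.laplacian w x‖ ^ 2) * Real.sqrt (∫ x, ‖w x‖ ^ 2)) ^ 2 :=
          pow_le_pow_left₀ hg0 hcs 2
      _ = (∫ x, ‖w x‖ ^ 2) * ∫ x, ‖Torus.laplacian w x‖ ^ 2 := by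
          rw [mul_pow, Real.sq_sqrt hA, Real.sq_sqrt hB, mul_comm]
  unfold torusEnstrophy Torus.kineticEnergy
  nlinarith [h]

/-- Along a classical torus solution with `K(u t) > 0` and `ν ≥ 0`: the dissipation term dominates
`2νℰ²/K`, i.e. `-ν‖Δu(t)‖₂² ≤ -2ν ℰ(u t)²/K(u t)`. [cite: AyalaProtas2017, eq. (2.6)] -/
theorem neg_nu_mul_laplacianSq_le {ν : ℝ} (hν : 0 ≤ ν) {w : UnitAddTorus d → EuclideanSpace ℝ d}
    (hw : Torus.IsSmooth w) (hK : 0 < Torus.kineticEnergy w) :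
    -ν * (∫ x, ‖Torus.laplacian w x‖ ^ 2) ≤
      -(2 * ν * torusEnstrophy w ^ 2 / Torus.kineticEnergy w) := by
  have h := two_mul_torusEnstrophy_sq_le hw
  have h1 : 2 * torusEnstrophy w ^ 2 / Torus.kineticEnergy w ≤ ∫ x, ‖Torus.laplacian w x‖ ^ 2 := by
    rw [div_le_iff₀ hK]; linarith [h]
  have h2 : 2 * ν * torusEnstrophy w ^ 2 / Torus.kineticEnergy w =
      ν * (2 * torusEnstrophy w ^ 2 / Torus.kineticEnergy w) := by ring
  rw [h2]
  nlinarith [h1, hν]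

/-- **The vortex-stretching bound `∫ω·Sω ≤ 2‖ω‖_∞ℰ`** in the tree's orthogonality form: for a
smooth divergence-free field on `T^d`, `card d = 3`, with `|ω(x)|² ≤ M²` pointwise (`0 ≤ M`),
`∫⟪Δu, (u·∇)u⟫ ≤ 2Mℰ(u)` (Betchov `∫tr(∇u)³ = 0` + pointwise `tr G³ - tr GGᵀG = ωᵀSω ≤ M|∇u|²`;
the stretching estimate inside Doering–Gibbon (6.5.18), isolated from the time derivative).
[cite: DoeringGibbon1995, §6.5 eq. (6.5.18)] -/
theorem integral_inner_laplacian_convect_le_two_mul_vorticityBound_mul_torusEnstrophy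
    (hd : Fintype.card d = 3) {u : UnitAddTorus d → EuclideanSpace ℝ d} (hu : Torus.IsSmooth u)
    (hdiv : Torus.IsDivFree u) {M : ℝ} (hM : 0 ≤ M) (hω : ∀ x, torusVorticitySqAt u x ≤ M ^ 2) :
    ∫ x, ⟪Torus.laplacian u x, Torus.convect u u x⟫_ℝ ≤ 2 * M * torusEnstrophy u := by
  have hD : ∀ m, Torus.IsSmooth (Torus.partialDeriv m u) := fun m => hu.partialDeriv m
  have hDc : ∀ m j, Torus.IsSmooth (fun y => Torus.partialDeriv m u y j) :=
    fun m j => (hD m).apply j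
  set B : UnitAddTorus d → ℝ := fun x => ∑ i, ∑ j, ∑ k, Torus.partialDeriv j u x i *
    Torus.partialDeriv k u x j * Torus.partialDeriv i u x k with hB_def
  set C : UnitAddTorus d → ℝ := fun x => ∑ m, ∑ i, Torus.partialDeriv m u x i *
    ⟪Torus.partialDeriv m u x, Torus.partialDeriv i u x⟫_ℝ with hC_def
  have hBs : Torus.IsSmooth B := by
    have h : ∀ i j k, Torus.IsSmooth (fun x => Torus.partialDeriv j u x i *
        Torus.partialDeriv k u x j * Torus.partialDeriv i u x k) :=
      fun i j k => ((hDc j i).mul (hDc k j)).mul (hDc i k)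
    unfold Torus.IsSmooth at h ⊢
    exact ContDiff.sum fun i _ => ContDiff.sum fun j _ => ContDiff.sum fun k _ => h i j k
  have hCs : Torus.IsSmooth C := by
    have h : ∀ m i, Torus.IsSmooth (fun x => Torus.partialDeriv m u x i *
        ⟪Torus.partialDeriv m u x, Torus.partialDeriv i u x⟫_ℝ) :=
      fun m i => (hDc m i).mul ((hD m).inner (hD i))
    unfold Torus.IsSmooth at h ⊢
    exact ContDiff.sum fun m _ => ContDiff.sum fun i _ => h m i
  have horth : ∫ x, ⟪Torus.laplacian u x, Torus.convect u u x⟫_ℝ = -∫ x, C x :=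
    Torus.integral_inner_laplacian_convect_self_eq_neg hu hdiv
  have hBet : ∫ x, B x = 0 := integral_sum_partialDeriv_cube_eq_zero hu hdiv
  have hdiff : -∫ x, C x = ∫ x, (B x - C x) := by
    rw [integral_sub hBs.integrable hCs.integrable, hBet, zero_sub]
  have hpt : ∀ x, B x - C x ≤ M * ∑ m, ‖Torus.partialDeriv m u x‖ ^ 2 := fun x =>
    sum_partialDeriv_cube_sub_stretch_le hd hu hdiv hM x (hω x)
  have hGs : Integrable (fun x => M * ∑ m, ‖Torus.partialDeriv m u x‖ ^ 2) :=
    (Torus.isSmooth_sum_norm_sq_partialDeriv hu).integrable.const_mul M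
  have hmono : ∫ x, (B x - C x) ≤ ∫ x, M * ∑ m, ‖Torus.partialDeriv m u x‖ ^ 2 :=
    integral_mono (hBs.integrable.sub hCs.integrable) hGs hpt
  have hgrad : ∫ x, M * ∑ m, ‖Torus.partialDeriv m u x‖ ^ 2 = 2 * M * torusEnstrophy u := by
    rw [integral_const_mul, ← Torus.gradNormSq, gradNormSq_eq_two_mul_torusEnstrophy]; ring
  rw [horth, hdiff]
  exact hmono.trans_eq hgrad

/-- **`dℰ/dt ≤ -2νℰ²/K + 2‖ω‖_∞ ℰ`** on `T³` (Ayala–Protas (2.6) first term — here with the sharp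
factor `2` — with the Doering–Gibbon (6.5.18) stretching bound): along a classical solution of the
unforced Navier–Stokes equations with `ν ≥ 0` on `T^d × [a, b]`, `card d = 3`, `a < b`, at
`t ∈ [a, b]` with `K(u t) > 0` and `|ω(t,x)|² ≤ M²` (`0 ≤ M`), every one-sided derivative `R` of
`s ↦ ℰ(u s)` within `[a, b]` at `t` satisfies `R ≤ -2νℰ(u t)²/K(u t) + 2Mℰ(u t)`.
[cite: AyalaProtas2017, eq. (2.6)] [cite: DoeringGibbon1995, §6.5 eq. (6.5.18)] -/
theorem _root_.Literature.Analysis.FunctionSpaces.Torus.IsClassicalNSSolutionOn.enstrophyRate_le_dissipationKE_vorticitySup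
    (hd : Fintype.card d = 3) {a b ν : ℝ} (hν : 0 ≤ ν)
    {u : ℝ → UnitAddTorus d → EuclideanSpace ℝ d} {p : ℝ → UnitAddTorus d → ℝ}
    (h : Torus.IsClassicalNSSolutionOn (Icc a b) ν 0 u p) (hab : a < b) {t : ℝ} (ht : t ∈ Icc a b)
    (hK : 0 < Torus.kineticEnergy (u t)) {M : ℝ} (hM : 0 ≤ M)
    (hω : ∀ x, torusVorticitySqAt (u t) x ≤ M ^ 2)
    (R : ℝ) (hR : HasDerivWithinAt (fun s => torusEnstrophy (u s)) R (Icc a b) t) :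
    R ≤ -(2 * ν * torusEnstrophy (u t) ^ 2 / Torus.kineticEnergy (u t)) +
      2 * M * torusEnstrophy (u t) := by
  have hut : Torus.IsSmooth (u t) := h.smooth_velocity.isSmooth_slice ht
  have hU : UniqueDiffWithinAt ℝ (Icc a b) t := uniqueDiffOn_Icc hab t ht
  have hbal := h.hasDerivWithinAt_half_gradNormSq hab ht
  have hReq : R = -ν * (∫ x, ‖Torus.laplacian (u t) x‖ ^ 2) +
      ∫ x, ⟪Torus.convect (u t) (u t) x - (0 : ℝ → UnitAddTorus d → EuclideanSpace ℝ d) t x,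
        Torus.laplacian (u t) x⟫_ℝ :=
    (hR.derivWithin hU).symm.trans (hbal.derivWithin hU)
  have hconv : ∫ x, ⟪Torus.convect (u t) (u t) x - (0 : ℝ → UnitAddTorus d → EuclideanSpace ℝ d) t x,
        Torus.laplacian (u t) x⟫_ℝ =
      ∫ x, ⟪Torus.laplacian (u t) x, Torus.convect (u t) (u t) x⟫_ℝ := by
    refine integral_congr_ae (Filter.Eventually.of_forall fun x => ?_)
    simp only [Pi.zero_apply, sub_zero]
    exact real_inner_comm _ _
  have hT := integral_inner_laplacian_convect_le_two_mul_vorticityBound_mul_torusEnstrophy hd hut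
    (h.divFree t ht) hM hω
  have hdiss := neg_nu_mul_laplacianSq_le hν hut hK
  rw [hReq, hconv]
  linarith

/-- **`dℰ/dt ≤ -2νℰ²/K + (2√6/9)∫|S|³`** on `T³` (Ayala–Protas (2.6) first term with Miller's
Cor. 4.9 stretching bound): same setting (`ν ≥ 0`, `K(u t) > 0`), every one-sided derivative `R`
of the enstrophy satisfies `R ≤ -2νℰ²/K + (2√6/9) ∫ F√F`, `F(x) = ∑ᵢⱼ Sᵢⱼ(x)²`.
[cite: AyalaProtas2017, eq. (2.6)] [cite: Miller2019, Cor. 4.9] -/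
theorem _root_.Literature.Analysis.FunctionSpaces.Torus.IsClassicalNSSolutionOn.enstrophyRate_le_dissipationKE_strain_cube
    (hd : Fintype.card d = 3) {a b ν : ℝ} (hν : 0 ≤ ν)
    {u : ℝ → UnitAddTorus d → EuclideanSpace ℝ d} {p : ℝ → UnitAddTorus d → ℝ}
    (h : Torus.IsClassicalNSSolutionOn (Icc a b) ν 0 u p) (hab : a < b) {t : ℝ} (ht : t ∈ Icc a b)
    (hK : 0 < Torus.kineticEnergy (u t))
    (R : ℝ) (hR : HasDerivWithinAt (fun s => torusEnstrophy (u s)) R (Icc a b) t) :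
    R ≤ -(2 * ν * torusEnstrophy (u t) ^ 2 / Torus.kineticEnergy (u t)) +
      (2 / 9) * Real.sqrt 6 * ∫ x,
        (∑ i, ∑ j, ((Torus.partialDeriv j (u t) x i + Torus.partialDeriv i (u t) x j) / 2) ^ 2) *
        Real.sqrt (∑ i, ∑ j,
          ((Torus.partialDeriv j (u t) x i + Torus.partialDeriv i (u t) x j) / 2) ^ 2) := by
  have hut : Torus.IsSmooth (u t) := h.smooth_velocity.isSmooth_slice ht
  have h1 := h.enstrophyRate_le_strain_cube hd hab ht R hR
  have hdiss := neg_nu_mul_laplacianSq_le hν hut hK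
  linarith

/-- **`dℰ/dt ≤ -2νℰ²/K + 2‖λ₂⁺‖_∞ ℰ`** on `T³` (Ayala–Protas (2.6) first term with Miller's
Lemma 5.1 / Thm. 1.1 `q = ∞` stretching bound): same setting (`ν ≥ 0`, `K(u t) > 0`), if the middle
eigenvalue of the strain `S(t, x)` is `≤ Λ` for all `x` (`0 ≤ Λ`), every one-sided derivative `R` of
the enstrophy satisfies `R ≤ -2νℰ²/K + 2Λℰ`.
[cite: AyalaProtas2017, eq. (2.6)] [cite: Miller2019, Lemma 5.1 and Thm. 1.1 (case q = ∞)] -/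
theorem _root_.Literature.Analysis.FunctionSpaces.Torus.IsClassicalNSSolutionOn.enstrophyRate_le_dissipationKE_middleEigenvalue
    (hd : Fintype.card d = 3) {a b ν : ℝ} (hν : 0 ≤ ν)
    {u : ℝ → UnitAddTorus d → EuclideanSpace ℝ d} {p : ℝ → UnitAddTorus d → ℝ}
    (h : Torus.IsClassicalNSSolutionOn (Icc a b) ν 0 u p) (hab : a < b) {t : ℝ} (ht : t ∈ Icc a b)
    (hK : 0 < Torus.kineticEnergy (u t)) {Λ : ℝ} (hΛ0 : 0 ≤ Λ)
    (hΛ : ∀ x, ∀ hx : (Matrix.of fun i j =>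
        (Torus.partialDeriv j (u t) x i + Torus.partialDeriv i (u t) x j) / 2).IsHermitian,
        hx.eigenvalues₀ (Fin.cast hd.symm 1) ≤ Λ)
    (R : ℝ) (hR : HasDerivWithinAt (fun s => torusEnstrophy (u s)) R (Icc a b) t) :
    R ≤ -(2 * ν * torusEnstrophy (u t) ^ 2 / Torus.kineticEnergy (u t)) +
      2 * Λ * torusEnstrophy (u t) := by
  have hut : Torus.IsSmooth (u t) := h.smooth_velocity.isSmooth_slice ht
  have h1 := h.enstrophyRate_le_middleEigenvalue_sup hd hab ht hΛ0 hΛ R hR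
  have hdiss := neg_nu_mul_laplacianSq_le hν hut hK
  linarith

end Literature.Analysis.FluidPDE
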